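import Literature.Analysis.FluidPDE.ZerothLaw
import Literature.Analysis.FluidPDE.LongTimeAverageNonneg
import HarnessLib

/-!
# Alexakis–Doering a-priori bounds for steadily forced two-dimensional turbulence

Named facts (statements only, `def … : Prop`) recording the three displayed steps of
Alexakis–Doering, *Energy and enstrophy dissipation in steady state 2d turbulence*, Phys. Lett.
A 359 (2006) 652–657, §2 (time-independent forcing; arXiv:physics/0605090), behind the two
bounds of that section for Leray–Hopf solutions of the incompressible Navier–Stokes equations on
`T²` driven by a steady force `f(x) = F Φ(x/ℓ)`:

* `AlexakisDoering2006_enstrophyDissipation_le`: `χ ≤ k_f² U F` — the enstrophy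
  production–dissipation balance `χ = ⟨ω φ⟩` followed by an integration by parts and
  Cauchy–Schwarz (op. cit. §2, display `χ ≤ k_f² U F`, "(VBI)").
* `AlexakisDoering2006_amplitude_le`: `F ≤ U² ‖∇v‖_∞ + ν U ‖Δv‖` for the smooth divergence-free
  multiplier `v = f/F` (op. cit. §2, display "(F1a)"; the two-dimensional twin of the accepted
  `Literature.Analysis.FluidPDE.DoeringFoias2002_amplitude_le`).
* `AlexakisDoering2006_dissipation_sq_le`: `⟨ω²⟩² ≤ ⟨|u|²⟩⟨|∇ω|²⟩`, i.e. `ε² ≤ ν U² χ`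
  (op. cit. §2, display "(trickI)", "integrations by parts and the Cauchy–Schwarz inequality").

Proved consequences (pure algebra on top of the named facts):

* `alexakis_doering_enstrophy_bound_of`: the first two facts imply the accepted turb.S25
  statement `Literature.Analysis.FluidPDE.alexakis_doering_enstrophy_bound`
  (`χ ≤ c₁ U³/ℓ³ + c₂ ν U²/ℓ⁴`, op. cit. §2, display "(Xbound)": `χ ≤ U³k_f³(C₁ + C₂/Re)`) with
  `c₁ = a·a'`, `c₂ = a·b'`.
* The final step `ε ≤ (ν U² χ)^{1/2} ≤ k_f U³ Re^{-1/2}(C₁ + C₂ Re⁻¹)^{1/2}` (op. cit. §2, last two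
  displays) is assembled in
  `Literature/Barriers/AnomalousDissipation/TwoDimensionalEnergyDissipationProofs.lean`, next to
  the barrier fact `Literature.Barriers.AnomalousDissipation.AlexakisDoering2006_energyDissipationBound`
  it serves.

## Conventions

Exactly those of `Literature.Analysis.FluidPDE.alexakis_doering_enstrophy_bound` (`ZerothLaw`) and of the
three-dimensional twin file `DoeringFoias`: unit torus `T² = UnitAddTorus (Fin 2)`, force
`ForcingShape.force Φ n F = F Φ(n • x)` (`ℓ = 1/n`, so `k_f ∝ n`; on the unit torus the source's
`k_f² = ‖Δf‖/‖f‖` is `n² ‖ΔΦ‖₂` for the `L²`-normalised shape, and the shape-dependent factor is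
absorbed into the constants, which the source itself allows to depend on the "shape" of `f`),
global Leray–Hopf solutions `Torus.IsGlobalLerayHopf` (unique and smooth for `t > 0` in 2-D),
*smooth* datum (the enstrophy dissipation `Turb.meanEnstrophyDissipation` is junk for rough data,
see its docstring), `U = rmsVelocity longTimeAvgSup u`, `ε = meanDissipation ν u`,
`χ = meanEnstrophyDissipation ν u`, all averages being `limsup` long-time averages whereas the
source assumes the limits exist ("The limit in the time average is assumed to exist for all the
quantities of interest", §2). The facts carry the hypothesis `0 < U`, implicit in the source
(which divides by `U` throughout, `β = ε/(k_f U³)`, `Re = U/(k_f ν)`); with the `limsup`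
convention it also records that the running means of the energy are eventually bounded (an
unbounded family has junk `limsup = sInf ∅ = 0`). The source takes `F = ‖f‖ ≥ 0`; here `F : ℝ`
and the bounds are stated with `|F|` (`F < 0` is the source applied to the shape `-Φ`).

## Mathlib search

Mathlib (this pin) has no Navier–Stokes / energy-dissipation notions (see `ZerothLaw`); nothing
to reuse beyond `Real.sqrt`, `abs`, `Filter.limsup` (through `TurbWave0`).

## References

* A. Alexakis, C. R. Doering, *Energy and enstrophy dissipation in steady state 2d turbulence*,
  Phys. Lett. A 359 (2006), 652–657, §2 (arXiv:physics/0605090). [AlexakisDoering2006PLA]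
* C. R. Doering, C. Foias, *Energy dissipation in body-forced turbulence*, J. Fluid Mech. 467
  (2002), 289–306 (the 3-D multiplier argument reused in "(F1a)").
-/

open MeasureTheory Filter Set
open scoped ENNReal NNReal RealInnerProductSpace

noncomputable section

namespace Literature.Analysis.FluidPDE

/-- The flat unit torus `T² = (ℝ/ℤ)²` (local notation). -/
local notation "𝕋²" => UnitAddTorus (Fin 2)
/-- Velocity values on `T²` (local notation). -/
local notation "E²" => EuclideanSpace ℝ (Fin 2)

/-! ### The named facts -/

section Facts

/-- **Alexakis–Doering bound on the enstrophy dissipation rate, `χ ≤ k_f² U F`**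
(Alexakis–Doering, Phys. Lett. A 359 (2006), §2, display "(VBI)": "we first take the inner
product of the vorticity equation with `ω` and average to obtain the enstrophy
production-dissipation balance `χ = ⟨ωφ⟩` … Integrating by parts to move the `k̂·∇×` from `ω`
onto `φ` and the Cauchy–Schwarz inequality, we easily obtain `χ ≤ k_f² U F`", with
`k_f² = ‖Δf‖/‖f‖`). Fix a forcing shape `Φ` on `T²`. There is a constant `a > 0` depending only
on `Φ` (in the source `a = ‖ΔΦ‖₂`, i.e. `k_f² = a n²` for `f = F Φ(n • x)`, `‖f‖₂ = |F|`) such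
that for every viscosity `ν > 0`, scale `ℓ = 1/n` (`n ∈ ℕ⁺`), amplitude `F`, smooth datum `u₀`
and global Leray–Hopf solution `u` of the 2-D Navier–Stokes equations on `T²` forced by
`F Φ(n • x)` with `U = ⟨‖u‖₂²⟩^{1/2} > 0`, the mean enstrophy dissipation rate
`χ = ν⟨‖Δu‖₂²⟩` obeys `χ ≤ a n² |F| U` (`limsup` averages; two-dimensional: the absence of
vortex stretching is what makes the enstrophy balance close). [cite: AlexakisDoering2006PLA, §2 display (VBI)] -/
def AlexakisDoering2006_enstrophyDissipation_le : Prop :=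
  ∀ (Φ : ForcingShape (Fin 2)), ∃ a : ℝ, 0 < a ∧
    ∀ ⦃ν : ℝ⦄, 0 < ν → ∀ ⦃n : ℕ⦄, 0 < n →
      ∀ (F : ℝ) (u₀ : 𝕋² → E²) (u : ℝ → 𝕋² → E²),
        FunctionSpaces.Torus.IsSmooth u₀ →
        Torus.IsGlobalLerayHopf ν (fun _ => Φ.force n F) u₀ u →
        0 < rmsVelocity longTimeAvgSup u →
          meanEnstrophyDissipation ν u ≤ a * (n : ℝ) ^ 2 * |F| * rmsVelocity longTimeAvgSup u

/-- **Alexakis–Doering bound on the forcing amplitude** (Alexakis–Doering, Phys. Lett. A 359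
(2006), §2, display "(F1a)": for a smooth incompressible multiplier `v`, "Take the inner product
of `v` with the Navier–Stokes equation, integrate by parts and average to obtain
`L⁻²∫ v·f = -⟨u·(∇v)·u + ν u·∇²v⟩`", whence by Cauchy–Schwarz and Hölder
`F · (L²‖f‖)⁻¹ ∫ v·f ≤ U²‖∇v‖_∞ + ν (U/L) ‖∇²v‖`; the choice `v = f/F` makes the left side `F`;
this is the two-dimensional twin of the accepted 3-D fact
`Literature.Analysis.FluidPDE.DoeringFoias2002_amplitude_le`, Doering–Foias 2002 §3). Fix a forcing shape `Φ` on
`T²`. There are constants `a, b > 0` depending only on `Φ` (`a = ‖∇Φ‖_∞`, `b = ‖ΔΦ‖₂` for the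
multiplier `v = Φ(n • x)`, using `‖∇(Φ(n • ·))‖_∞ = n‖∇Φ‖_∞`, `‖Δ(Φ(n • ·))‖₂ = n²‖ΔΦ‖₂`) such
that for every `ν > 0`, `ℓ = 1/n` (`n ∈ ℕ⁺`), amplitude `F`, datum `u₀` and global Leray–Hopf
solution `u` on `T²` forced by `F Φ(n • x)` with `U = ⟨‖u‖₂²⟩^{1/2} > 0`:
`|F| ≤ a U²/ℓ + b ν U/ℓ²` (`limsup` averages; the time-derivative term averages to zero because
`‖u(t)‖₂` is bounded). Stated with `|F|`; the hypothesis `0 < U` (implicit in the source) is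
added, see the module docstring. [cite: AlexakisDoering2006PLA, §2 display (F1a)] -/
def AlexakisDoering2006_amplitude_le : Prop :=
  ∀ (Φ : ForcingShape (Fin 2)), ∃ a b : ℝ, 0 < a ∧ 0 < b ∧
    ∀ ⦃ν : ℝ⦄, 0 < ν → ∀ ⦃n : ℕ⦄, 0 < n →
      ∀ (F : ℝ) (u₀ : 𝕋² → E²) (u : ℝ → 𝕋² → E²),
        Torus.IsGlobalLerayHopf ν (fun _ => Φ.force n F) u₀ u →
        0 < rmsVelocity longTimeAvgSup u →
          |F| ≤ a * rmsVelocity longTimeAvgSup u ^ 2 / (n : ℝ)⁻¹ +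
            b * ν * rmsVelocity longTimeAvgSup u / (n : ℝ)⁻¹ ^ 2

/-- **Alexakis–Doering interpolation step `ε² ≤ ν U² χ`** (Alexakis–Doering, Phys. Lett. A 359
(2006), §2, display "(trickI)": "we use integrations by parts and the Cauchy–Schwarz inequality
to see that `⟨ω²⟩² = ⟨u·∇×(k̂ω)⟩² ≤ ⟨|u|²⟩⟨|∇ω|²⟩`"; multiplied by `ν²` this reads
`ε² ≤ U² · ν χ` with `ε = ν⟨ω²⟩ = ν⟨|∇u|²⟩`, `χ = ν⟨|∇ω|²⟩ = ν⟨|Δu|²⟩`). For every forcing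
shape `Φ` on `T²`, `ν > 0`, `ℓ = 1/n` (`n ∈ ℕ⁺`), amplitude `F`, *smooth* datum `u₀` and global
Leray–Hopf solution `u` on `T²` forced by `F Φ(n • x)` with `U = ⟨‖u‖₂²⟩^{1/2} > 0`:
`ε² ≤ ν U² χ` with `ε = meanDissipation ν u` (spectral `‖∇u‖₂²`) and
`χ = meanEnstrophyDissipation ν u` (spectral `‖Δu‖₂²`), `limsup` averages. In Fourier variables
the spatial step is the Cauchy–Schwarz inequality `(∑|k|²|û_k|²)² ≤ (∑|û_k|²)(∑|k|⁴|û_k|²)`;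
the time step is Cauchy–Schwarz for the running means followed by `limsup`; smoothness of the
datum (2-D: the solution is then smooth with `‖Δu(t)‖₂²` locally integrable and its running
means bounded, by the enstrophy balance) keeps `χ` free of junk values. [cite: AlexakisDoering2006PLA, §2 display (trickI)] -/
def AlexakisDoering2006_dissipation_sq_le : Prop :=
  ∀ (Φ : ForcingShape (Fin 2)) ⦃ν : ℝ⦄, 0 < ν → ∀ ⦃n : ℕ⦄, 0 < n →
    ∀ (F : ℝ) (u₀ : 𝕋² → E²) (u : ℝ → 𝕋² → E²),
      FunctionSpaces.Torus.IsSmooth u₀ →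
      Torus.IsGlobalLerayHopf ν (fun _ => Φ.force n F) u₀ u →
      0 < rmsVelocity longTimeAvgSup u →
        meanDissipation ν u ^ 2 ≤
          ν * rmsVelocity longTimeAvgSup u ^ 2 * meanEnstrophyDissipation ν u

end Facts

/-! ### Consequences -/

section Consequences

/-- Elementary algebra of "(Xbound)": `χ ≤ a n² |F| U` and `|F| ≤ a' U² n + b' ν U n²` give
`χ ≤ (a a') U³ n³ + (a b') ν U² n⁴ = alexakisDoeringRHS (a a') (a b') ν U n⁻¹` for `a, U ≥ 0`,
`n ≠ 0` (Alexakis–Doering 2006, §2). [cite: AlexakisDoering2006PLA, §2 display (Xbound)] -/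
theorem le_alexakisDoeringRHS_of_le_of_amplitude_le {χ a a' b' F ν U n : ℝ} (ha : 0 ≤ a)
    (hU : 0 ≤ U) (hn : n ≠ 0) (hχ : χ ≤ a * n ^ 2 * |F| * U)
    (hF : |F| ≤ a' * U ^ 2 / n⁻¹ + b' * ν * U / n⁻¹ ^ 2) :
    χ ≤ alexakisDoeringRHS (a * a') (a * b') ν U n⁻¹ := by
  have h1 : a * n ^ 2 * |F| * U ≤ a * n ^ 2 * (a' * U ^ 2 / n⁻¹ + b' * ν * U / n⁻¹ ^ 2) * U := by
    have han : 0 ≤ a * n ^ 2 := mul_nonneg ha (sq_nonneg n)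
    exact mul_le_mul_of_nonneg_right (mul_le_mul_of_nonneg_left hF han) hU
  have h2 : a * n ^ 2 * (a' * U ^ 2 / n⁻¹ + b' * ν * U / n⁻¹ ^ 2) * U =
      alexakisDoeringRHS (a * a') (a * b') ν U n⁻¹ := by
    unfold alexakisDoeringRHS
    field_simp
  exact (hχ.trans h1).trans_eq h2

/-- **The Alexakis–Doering chain `χ ≤ k_f² U F ≤ k_f² U (a' U² k_f + b' ν U k_f²)`**
(Alexakis–Doering 2006, §2, display "(Xbound)": "we can choose `v` appropriately and use (F1a)
to eliminate `F` in (VBI) so that `χ ≤ U³ k_f³ (C₁ + C₂/Re)`"): the two named facts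
`AlexakisDoering2006_enstrophyDissipation_le` and `AlexakisDoering2006_amplitude_le` imply the
turb.S25 statement `Literature.Analysis.FluidPDE.alexakis_doering_enstrophy_bound` with `c₁ = a a'`, `c₂ = a b'`. [cite: AlexakisDoering2006PLA, §2 display (Xbound)] -/
theorem alexakis_doering_enstrophy_bound_of (h₁ : AlexakisDoering2006_enstrophyDissipation_le)
    (h₂ : AlexakisDoering2006_amplitude_le) : alexakis_doering_enstrophy_bound := by
  intro Φ
  obtain ⟨a, ha, hχ⟩ := h₁ Φ
  obtain ⟨a', b', ha', hb', hF⟩ := h₂ Φ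
  refine ⟨a * a', a * b', mul_pos ha ha', mul_pos ha hb', fun ν hν n hn F u₀ u hu₀ hu hU => ?_⟩
  have hn' : (n : ℝ) ≠ 0 := Nat.cast_ne_zero.mpr hn.ne'
  exact le_alexakisDoeringRHS_of_le_of_amplitude_le ha.le hU.le hn'
    (hχ hν hn F u₀ u hu₀ hu hU) (hF hν hn F u₀ u hu hU)

/-- In dimensionless form (Alexakis–Doering 2006, §2, "(Xbound) ⇒ `γ ≤ C₁ + C₂/Re`"): under the
two facts, `γ = χ ℓ³/U³ ≤ c₁ + c₂ Re⁻¹` with `Re = U ℓ/ν` (`Turb.reynoldsNumber`), `ℓ = 1/n`,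
whenever `U > 0`. [cite: AlexakisDoering2006PLA, §2 display (Xbound)] -/
theorem enstrophyDissipationCoeff_le_of (h₁ : AlexakisDoering2006_enstrophyDissipation_le)
    (h₂ : AlexakisDoering2006_amplitude_le) (Φ : ForcingShape (Fin 2)) :
    ∃ c₁ c₂ : ℝ, 0 < c₁ ∧ 0 < c₂ ∧ ∀ ⦃ν : ℝ⦄, 0 < ν → ∀ ⦃n : ℕ⦄, 0 < n →
      ∀ (F : ℝ) (u₀ : 𝕋² → E²) (u : ℝ → 𝕋² → E²),
        FunctionSpaces.Torus.IsSmooth u₀ →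
        Torus.IsGlobalLerayHopf ν (fun _ => Φ.force n F) u₀ u →
        0 < rmsVelocity longTimeAvgSup u →
          meanEnstrophyDissipation ν u * (n : ℝ)⁻¹ ^ 3 / rmsVelocity longTimeAvgSup u ^ 3 ≤
            c₁ + c₂ * (reynoldsNumber (rmsVelocity longTimeAvgSup u) (n : ℝ)⁻¹ ν)⁻¹ := by
  obtain ⟨c₁, c₂, hc₁, hc₂, hb⟩ := alexakis_doering_enstrophy_bound_of h₁ h₂ Φ
  refine ⟨c₁, c₂, hc₁, hc₂, fun ν hν n hn F u₀ u hu₀ hu hU => ?_⟩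
  have h := hb ν hν n hn F u₀ u hu₀ hu hU
  set U := rmsVelocity longTimeAvgSup u
  set ℓ : ℝ := (n : ℝ)⁻¹
  have hℓ : 0 < ℓ := by positivity
  unfold reynoldsNumber
  unfold alexakisDoeringRHS at h
  rw [div_le_iff₀ (by positivity)]
  have : (c₁ + c₂ * (U * ℓ / ν)⁻¹) * U ^ 3 = (c₁ * U ^ 3 / ℓ ^ 3 + c₂ * ν * U ^ 2 / ℓ ^ 4) * ℓ ^ 3 := by
    field_simp
  rw [this]
  exact mul_le_mul_of_nonneg_right h (by positivity)

end Consequences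

end Literature.Analysis.FluidPDE

end
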